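import Mathlib.Data.Rat.Defs
import Std.Data.HashMap
import HarnessLib

/-!
# Kummer orbifold model — basics: sparse exterior algebra over `ℚ`, permutations, modular linear algebra

Area `Literature/Computation/KummerOrbifold` (compute infrastructure, cell `hodge-kum4`, seat p1): a
COMPUTABLE model of the orbifold cohomology ring `H*_{orb,dt}([A_0^m/𝔖_m]) ≅ H*(K_{m-1}(A), ℚ)`
(Fu–Tian–Vial 2019, Thm. 1.5; Fantechi–Göttsche 2003 §3 for the product), restricted to the part
invariant under the translation group `A[m]`, in the conventions of the cell's census implementation
g2 (`run/shared/lean/pub/gate-kummer/census-g2/code/kfg.py`, independently validated against g0):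
`V = H¹(A, ℚ)` with basis `e_0..e_3`, `∫_A e_0 e_1 e_2 e_3 = 1`; generators `e_a^{(i)}` = bit
`4 i + a`; monomials = bit masks.  This file: the sparse exterior algebra on bit-indexed generators
(`Ext`, hash-map backed), table-driven popcount/sign kernels, permutations of `{0..m-1}` and set
partitions, truncated integer polynomials (Molien counts), combinations, a deterministic shuffle,
arithmetic mod `p = 2³¹ - 1`, modular and exact Gauss–Jordan.  Everything is plumbing (definitions
only, no theorems); the mathematics enters in `Sectors` (the FTV/FG product) and is CERTIFIED by
computation in `Certificate5`.

Sources: L. Fu, Z. Tian, C. Vial, *Motivic hyper-Kähler resolution conjecture I: generalized Kummer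
varieties*, Geom. Topol. 23 (2019), Thm. 1.4/1.5 (arXiv:1608.04968 p. 4–5); B. Fantechi, L. Göttsche,
*Orbifold cohomology for global quotients*, Duke Math. J. 117 (2003), §3.
-/

set_option autoImplicit false

namespace Literature.Computation.KummerOrbifold

/-! ## Sparse exterior algebra -/


/-- `Ext` (plumbing of the computable orbifold model). [folklore] -/
abbrev Ext := Std.HashMap Nat Rat

namespace Ext

/-- (plumbing) [folklore] -/
@[inline] def mk : Ext := Std.HashMap.emptyWithCapacity 16
/-- (plumbing) [folklore] -/
def one : Ext := mk.insert 0 1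
/-- (plumbing) [folklore] -/
def single (m : Nat) (c : Rat) : Ext := if c == 0 then mk else mk.insert m c

/-- (plumbing) [folklore] -/
@[inline] def addTerm (A : Ext) (m : Nat) (c : Rat) : Ext :=
  if c == 0 then A else
  match A.get? m with
  | none => A.insert m c
  | some v => let w := v + c; if w == 0 then A.erase m else A.insert m w

/-- `acc + c • A`. [folklore] -/
def addInto (acc A : Ext) (c : Rat := 1) : Ext :=
  if c == 1 then A.fold (fun acc m v => acc.addTerm m v) acc
  else A.fold (fun acc m v => acc.addTerm m (c * v)) acc

/-- (plumbing) [folklore] -/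
def scale (A : Ext) (c : Rat) : Ext :=
  if c == 0 then mk else A.fold (fun acc m v => acc.insert m (v * c)) mk

/-- (plumbing) [folklore] -/
def popcount (x : Nat) : Nat := Id.run do
  let mut n := 0
  let mut y := x
  while y != 0 do
    n := n + (y &&& 1)
    y := y >>> 1
  return n

/-- sign of `e_{m1} ∧ e_{m2}`: number of pairs `(i ∈ m1, j ∈ m2)` with `i > j`; none if overlap [folklore] -/
@[inline] def monoSignNeg? (m1 m2 : Nat) : Option Bool :=
  if m1 &&& m2 != 0 then none else Id.run do
    let mut s := 0
    let mut x := m1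
    let mut pos := 0
    while x != 0 do
      if x &&& 1 == 1 then
        s := s + popcount (m2 &&& ((1 <<< pos) - 1))
      x := x >>> 1
      pos := pos + 1
    return some (s % 2 == 1)

/-- (plumbing) [folklore] -/
def wedge (A B : Ext) : Ext :=
  A.fold (fun acc m1 c1 =>
    B.fold (fun acc2 m2 c2 =>
      match monoSignNeg? m1 m2 with
      | none => acc2
      | some neg => acc2.addTerm (m1 ||| m2) (if neg then -(c1 * c2) else c1 * c2)) acc) mk

/-- set bits, increasing [folklore] -/
def bits (m : Nat) : Array Nat := Id.run do
  let mut out : Array Nat := #[]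
  let mut x := m
  let mut pos := 0
  while x != 0 do
    if x &&& 1 == 1 then out := out.push pos
    x := x >>> 1
    pos := pos + 1
  return out

/-- substitute generators by linear forms: `table[b] = some form` replaces generator `b`; others kept [folklore] -/
def subst (A : Ext) (table : Nat → Option Ext) : Ext :=
  A.fold (fun acc m c =>
    let cur := (bits m).foldl (fun (cur : Ext) b =>
      if cur.isEmpty then cur else
        match table b with
        | none => wedge cur (single (1 <<< b) 1)
        | some img => wedge cur img) (single 0 c)
    addInto acc cur) mk

/-- number of inversions [folklore] -/
def inversions (l : Array Nat) : Nat := Id.run do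
  let mut inv := 0
  for i in [0:l.size] do
    for j in [i+1:l.size] do
      if l[i]! > l[j]! then inv := inv + 1
  return inv

/-- relabel coordinates: generator `(i,a) ↦ (cmap i, a)` [folklore] -/
def relabel (A : Ext) (cmap : Nat → Nat) : Ext :=
  A.fold (fun acc m c =>
    let nb := (bits m).map (fun b => 4 * cmap (b / 4) + b % 4)
    -- duplicate check
    let nm := nb.foldl (fun (st : Option Nat) b => match st with
      | none => none
      | some x => if x &&& (1 <<< b) != 0 then none else some (x ||| (1 <<< b))) (some 0)
    match nm with
    | none => acc
    | some nm => acc.addTerm nm (if inversions nb % 2 == 1 then -c else c)) mk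

/-- interior product by a linear functional `phi : bit → coeff` (graded derivation of degree -1) [folklore] -/
def contract (A : Ext) (phi : Nat → Rat) : Ext :=
  A.fold (fun acc m c =>
    let bs := bits m
    (List.range bs.size).foldl (fun (acc : Ext) j =>
      let b := bs[j]!
      let f := phi b
      if f == 0 then acc else
        acc.addTerm (m ^^^ (1 <<< b)) (if j % 2 == 0 then c * f else -(c * f))) acc) mk

/-- interior product by the dual of ONE generator `b`: `ι_b` [folklore] -/
def contractBit (A : Ext) (b : Nat) : Ext :=
  let bm := 1 <<< b
  A.fold (fun acc m c =>
    if m &&& bm == 0 then acc else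
      -- position of b among the set bits of m = popcount of lower bits
      let j := popcount (m &&& (bm - 1))
      acc.addTerm (m ^^^ bm) (if j % 2 == 0 then c else -c)) mk

/-- (plumbing) [folklore] -/
def degreePart (A : Ext) (d : Nat) : Ext :=
  A.fold (fun acc m c => if popcount m == d then acc.insert m c else acc) mk

/-- (plumbing) [folklore] -/
def beq (A B : Ext) : Bool :=
  A.size == B.size && A.fold (fun ok m c => ok && B.get? m == some c) true

end Ext


/-! ## Table-driven popcount and wedge signs -/


/-- `popTable` (plumbing of the computable orbifold model). [folklore] -/
def popTable : Array Nat := (Array.range 256).map (fun x => Id.run do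
  let mut n := 0
  let mut y := x
  while y != 0 do
    n := n + (y &&& 1)
    y := y >>> 1
  return n)

/-- (plumbing) [folklore] -/
@[inline] def pop32 (x : Nat) : Nat :=
  popTable[x &&& 255]! + popTable[(x >>> 8) &&& 255]! + popTable[(x >>> 16) &&& 255]! + popTable[(x >>> 24) &&& 255]!

/-- sign of `e_t ∧ e_m` (disjoint assumed): parity of `#{(i ∈ t, j ∈ m) : i > j}` [folklore] -/
@[inline] def signNegTM (t m : Nat) : Bool := Id.run do
  let mut s := 0
  let mut x := t
  while x != 0 do
    let rest := x &&& (x - 1)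
    let low := x ^^^ rest          -- lowest set bit of x
    s := s + pop32 (m &&& (low - 1))
    x := rest
  return s % 2 == 1


/-! ## Permutations and partitions -/


/-- `Perm` (plumbing of the computable orbifold model). [folklore] -/
abbrev Perm := Array Nat

namespace Perm
/-- (plumbing) [folklore] -/
def compose (g h : Perm) : Perm := (Array.range g.size).map (fun i => g[h[i]!]!)
/-- (plumbing) [folklore] -/
def inv (g : Perm) : Perm := Id.run do
  let mut r := Array.replicate g.size 0
  for i in [0:g.size] do r := r.set! g[i]! i
  return r
/-- (plumbing) [folklore] -/
def code (g : Perm) : Nat := (List.range g.size).foldl (fun acc i => acc + g[i]! * g.size ^ i) 0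
/-- orbits (blocks sorted by min, each block increasing) [folklore] -/
def orbits (g : Perm) : Array (Array Nat) := Id.run do
  let n := g.size
  let mut seen := Array.replicate n false
  let mut out : Array (Array Nat) := #[]
  for i in [0:n] do
    if !seen[i]! then
      let mut o : Array Nat := #[]
      let mut j := i
      while !seen[j]! do
        seen := seen.set! j true
        o := o.push j
        j := g[j]!
      out := out.push (o.qsort (· < ·))
  return out
/-- (plumbing) [folklore] -/
def length (g : Perm) : Nat := g.size - (orbits g).size
/-- (plumbing) [folklore] -/
def cycleType (g : Perm) : List Nat := (((orbits g).map (·.size)).qsort (· > ·)).toList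
end Perm

/-- (plumbing) [folklore] -/
def permsOf (l : List Nat) : List (List Nat) :=
  go l.length l
where
  /-- fuelled recursion (fuel = length; the elements are distinct) [folklore] -/
  go : Nat → List Nat → List (List Nat)
    | 0, _ => [[]]
    | n + 1, l =>
      match l with
      | [] => [[]]
      | _ => l.flatMap (fun a => (go n (l.filter (· != a))).map (fun t => a :: t))

/-- join of two partitions of `{0..m-1}` (as arrays of sorted blocks), blocks sorted by min [folklore] -/
def joinPartitions (P Q : Array (Array Nat)) (m : Nat) : Array (Array Nat) := Id.run do
  let mut lab : Array Nat := Array.range m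
  let mut changed := true
  while changed do
    changed := false
    for part in [P, Q] do
      for B in part do
        let mn := B.foldl (fun a i => min a lab[i]!) m
        for i in B do
          if lab[i]! != mn then
            lab := lab.set! i mn
            changed := true
    -- propagate labels to fixpoint
    for i in [0:m] do
      let r := lab[lab[i]!]!
      if r != lab[i]! then
        lab := lab.set! i r
        changed := true
  let mut out : Array (Array Nat) := #[]
  for r in [0:m] do
    if lab[r]! == r then out := out.push ((Array.range m).filter (fun i => lab[i]! == r))
  return out


end Literature.Computation.KummerOrbifold
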